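import Summits.Ventures.PercRepro.S1CircuitSeparatorConsumers
import Summits.Ventures.PercRepro.S1DisjointSumSixThree
import Summits.Ventures.PercRepro.S1DisjointSumFiveFour
import Summits.Ventures.PercRepro.S1DisjointSumThreeSix
import Summits.Ventures.PercRepro.S1DisjointSumFourFive
import Summits.Ventures.PercRepro.S1DisjointSumRankTwoParts

/-!
# PercRepro — THE FOUR NON-CIRCUIT SPLITS OF THE `(9, 5)` CELL IN THE TREE'S RLS FORM (p2, gen 28; SUBCLAIM-S1
§6.10 (xvii)(j))

Through the bridge `eq_disjointSum_restrict_of_separator`, the consumers `S1DisjointSumSixThree`, `…FiveFour`,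
`…ThreeSix`, `…FourFive` apply to a finite matroid `M` of rank `9` on `14` points that HAS a separator `A`
(`ρ(A) + ρ(E ∖ A) = ρ(E)`) of the corresponding shape: `ThmN.RLS M 9 4` when `A` has `5` points and rank `3`;
`6` points and rank `4` (`M` coloop-free); `6` points and rank `3` or `7` points and rank `4` (`M` coloop-free,
all pairs of rank `2`). Together with `S1CircuitSeparatorConsumers` (a circuit separator of any size) these are
ALL the shapes of a `1`-separable `(9, 5)` core whose rank-`2` parts are triangles — so such a core satisfies
the `(9, 4)` body. Nothing else is claimed about any cell.

* **`rls_nine_four_of_six_three_separator`**, **`rls_nine_four_of_five_four_separator`**,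
  **`rls_nine_four_of_three_six_separator`**, **`rls_nine_four_of_four_five_separator`**,
  **`rls_nine_four_of_four_point_line_separator`**, **`rls_nine_four_of_five_point_line_separator`**.
Axioms: standard.
-/

open scoped Matroid

namespace PercRepro

namespace S1

open Set

variable {α : Type}

/-- **`(9, 4)` for a matroid of rank `9` on `14` points with a simple rank-`3` separator of `5` points** — the
`(6, 3)` split of the `(9, 5)` cell: `M = (M ↾ (E ∖ A)) ⊕ (M ↾ A)` with the first part of rank `6` on `9`
points. -/
theorem rls_nine_four_of_six_three_separator (M : Matroid α) [M.Finite] {A : Set α} (hA : A ⊆ M.E)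
    (hsep : M.eRk A + M.eRk (M.E \ A) = M.eRank) (hA5 : A.ncard = 5) (hrA : M.eRk A = ((3 : ℕ) : ℕ∞))
    (hpairs : ∀ e ∈ A, ∀ f ∈ A, e ≠ f → M.eRk {e, f} = 2) (hM : M.eRank = ((9 : ℕ) : ℕ∞))
    (hE : M.E.ncard = 14) : ThmN.RLS M 9 4 := by
  have hB : M.E \ A ⊆ M.E := sdiff_subset
  have hsep' : M.eRk (M.E \ A) + M.eRk (M.E \ (M.E \ A)) = M.eRank := by
    rw [sdiff_sdiff_cancel_left hA, add_comm]; exact hsep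
  have heq := eq_disjointSum_restrict_of_separator M hB hsep'
  haveI hBfin : (M ↾ (M.E \ A)).Finite := Matroid.restrict_finite (M.ground_finite.subset hB)
  haveI hAfin : (M ↾ A).Finite := Matroid.restrict_finite (M.ground_finite.subset hA)
  -- the ranks of the parts
  have hrB : (M ↾ (M.E \ A)).eRank = ((6 : ℕ) : ℕ∞) := by
    rw [Matroid.eRank_restrict]
    have h := hsep
    rw [hrA, hM] at h
    have hfin : M.eRk (M.E \ A) ≠ ⊤ :=
      ((M.eRk_le_encard _).trans_lt (M.ground_finite.subset hB).encard_lt_top).ne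
    obtain ⟨r, hr⟩ := ENat.ne_top_iff_exists.mp hfin
    rw [← hr] at h ⊢
    have h' : 3 + r = 9 := by exact_mod_cast h
    have hr6 : r = 6 := by omega
    rw [hr6]
  have hBE : (M ↾ (M.E \ A)).E.ncard = 9 := by
    rw [Matroid.restrict_ground_eq, ncard_sdiff' hA M.ground_finite, hE, hA5]
  have hrA' : (M ↾ A).eRank = ((3 : ℕ) : ℕ∞) := by rw [Matroid.eRank_restrict]; exact hrA
  have hAE' : (M ↾ A).E.ncard = 5 := by rw [Matroid.restrict_ground_eq]; exact hA5
  have hpairs' : ∀ e ∈ (M ↾ A).E, ∀ f ∈ (M ↾ A).E, e ≠ f → (M ↾ A).eRk {e, f} = 2 := by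
    intro e he f hf hef
    rw [Matroid.restrict_ground_eq] at he hf
    rw [M.restrict_eRk_eq (show ({e, f} : Set α) ⊆ A from by
      intro x hx
      rcases hx with rfl | rfl
      · exact he
      · exact hf)]
    exact hpairs e he f hf hef
  unfold ThmN.RLS
  rw [heq]
  -- the disjoint-sum ground set is `(E ∖ A) ∪ (E ∖ (E ∖ A))`; rewrite the second part to `A`
  have hAA : M.E \ (M.E \ A) = A := sdiff_sdiff_cancel_left hA
  have key := c025_nine_four_disjointSum_six_three (M ↾ (M.E \ A)) (M ↾ A)
    (by simp only [Matroid.restrict_ground_eq]; exact disjoint_sdiff_left) hrB hBE hrA' hAE' hpairs'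
  convert key using 3 <;> simp only [hAA]

/-- **`(9, 4)` for a coloop-free matroid of rank `9` on `14` points with a simple rank-`4` separator of `6`
points** — the `(5, 4)` split of the `(9, 5)` cell: `M = (M ↾ (E ∖ A)) ⊕ (M ↾ A)` with the first part coloop-free
of rank `5` on `8` points. -/
theorem rls_nine_four_of_five_four_separator (M : Matroid α) [M.Finite] {A : Set α} (hA : A ⊆ M.E)
    (hsep : M.eRk A + M.eRk (M.E \ A) = M.eRank) (hA6 : A.ncard = 6) (hrA : M.eRk A = ((4 : ℕ) : ℕ∞))
    (hpairs : ∀ e ∈ A, ∀ f ∈ A, e ≠ f → M.eRk {e, f} = 2) (hM : M.eRank = ((9 : ℕ) : ℕ∞))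
    (hE : M.E.ncard = 14) (hcol : M.coloops = ∅) : ThmN.RLS M 9 4 := by
  have hB : M.E \ A ⊆ M.E := sdiff_subset
  have hsep' : M.eRk (M.E \ A) + M.eRk (M.E \ (M.E \ A)) = M.eRank := by
    rw [sdiff_sdiff_cancel_left hA, add_comm]; exact hsep
  have heq := eq_disjointSum_restrict_of_separator M hB hsep'
  haveI hBfin : (M ↾ (M.E \ A)).Finite := Matroid.restrict_finite (M.ground_finite.subset hB)
  haveI hAfin : (M ↾ A).Finite := Matroid.restrict_finite (M.ground_finite.subset hA)
  have hcolB : (M ↾ (M.E \ A)).coloops = ∅ := restrict_coloops_eq_empty_of_separator M hB hsep' hcol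
  have hrB : (M ↾ (M.E \ A)).eRank = ((5 : ℕ) : ℕ∞) := by
    rw [Matroid.eRank_restrict]
    have h := hsep
    rw [hrA, hM] at h
    have hfin : M.eRk (M.E \ A) ≠ ⊤ :=
      ((M.eRk_le_encard _).trans_lt (M.ground_finite.subset hB).encard_lt_top).ne
    obtain ⟨r, hr⟩ := ENat.ne_top_iff_exists.mp hfin
    rw [← hr] at h ⊢
    have h' : 4 + r = 9 := by exact_mod_cast h
    have hr5 : r = 5 := by omega
    rw [hr5]
  have hBE : (M ↾ (M.E \ A)).E.ncard = 8 := by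
    rw [Matroid.restrict_ground_eq, ncard_sdiff' hA M.ground_finite, hE, hA6]
  have hrA' : (M ↾ A).eRank = ((4 : ℕ) : ℕ∞) := by rw [Matroid.eRank_restrict]; exact hrA
  have hAE' : (M ↾ A).E.ncard = 6 := by rw [Matroid.restrict_ground_eq]; exact hA6
  have hpairs' : ∀ e ∈ (M ↾ A).E, ∀ f ∈ (M ↾ A).E, e ≠ f → (M ↾ A).eRk {e, f} = 2 := by
    intro e he f hf hef
    rw [Matroid.restrict_ground_eq] at he hf
    rw [M.restrict_eRk_eq (show ({e, f} : Set α) ⊆ A from by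
      intro x hx
      rcases hx with rfl | rfl
      · exact he
      · exact hf)]
    exact hpairs e he f hf hef
  unfold ThmN.RLS
  rw [heq]
  have hAA : M.E \ (M.E \ A) = A := sdiff_sdiff_cancel_left hA
  have key := c025_nine_four_disjointSum_five_four (M ↾ (M.E \ A)) (M ↾ A)
    (by simp only [Matroid.restrict_ground_eq]; exact disjoint_sdiff_left) hrB hBE hcolB hrA' hAE' hpairs'
  convert key using 3 <;> simp only [hAA]

/-- **`(9, 4)` for a coloop-free simple matroid of rank `9` on `14` points with a rank-`3` separator of `6`
points** — the `(3, 6)` split of the `(9, 5)` cell: `M = (M ↾ (E ∖ A)) ⊕ (M ↾ A)` with the first part coloop-free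
of rank `6` on `8` points, the second coloop-free of rank `3` on `6` points. -/
theorem rls_nine_four_of_three_six_separator (M : Matroid α) [M.Finite] {A : Set α} (hA : A ⊆ M.E)
    (hsep : M.eRk A + M.eRk (M.E \ A) = M.eRank) (hA6 : A.ncard = 6) (hrA : M.eRk A = ((3 : ℕ) : ℕ∞))
    (hpairs : ∀ e ∈ M.E, ∀ f ∈ M.E, e ≠ f → M.eRk {e, f} = 2) (hM : M.eRank = ((9 : ℕ) : ℕ∞))
    (hE : M.E.ncard = 14) (hcol : M.coloops = ∅) : ThmN.RLS M 9 4 := by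
  have hB : M.E \ A ⊆ M.E := sdiff_subset
  have hsep' : M.eRk (M.E \ A) + M.eRk (M.E \ (M.E \ A)) = M.eRank := by
    rw [sdiff_sdiff_cancel_left hA, add_comm]; exact hsep
  have heq := eq_disjointSum_restrict_of_separator M hB hsep'
  haveI hBfin : (M ↾ (M.E \ A)).Finite := Matroid.restrict_finite (M.ground_finite.subset hB)
  haveI hAfin : (M ↾ A).Finite := Matroid.restrict_finite (M.ground_finite.subset hA)
  have hcolB : (M ↾ (M.E \ A)).coloops = ∅ := restrict_coloops_eq_empty_of_separator M hB hsep' hcol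
  have hcolA : (M ↾ A).coloops = ∅ := restrict_coloops_eq_empty_of_separator M hA hsep hcol
  have hrB : (M ↾ (M.E \ A)).eRank = ((6 : ℕ) : ℕ∞) := by
    rw [Matroid.eRank_restrict]
    have h := hsep
    rw [hrA, hM] at h
    have hfin : M.eRk (M.E \ A) ≠ ⊤ :=
      ((M.eRk_le_encard _).trans_lt (M.ground_finite.subset hB).encard_lt_top).ne
    obtain ⟨r, hr⟩ := ENat.ne_top_iff_exists.mp hfin
    rw [← hr] at h ⊢
    have h' : 3 + r = 9 := by exact_mod_cast h
    have hr6 : r = 6 := by omega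
    rw [hr6]
  have hBE : (M ↾ (M.E \ A)).E.ncard = 8 := by
    rw [Matroid.restrict_ground_eq, ncard_sdiff' hA M.ground_finite, hE, hA6]
  have hrA' : (M ↾ A).eRank = ((3 : ℕ) : ℕ∞) := by rw [Matroid.eRank_restrict]; exact hrA
  have hAE' : (M ↾ A).E.ncard = 6 := by rw [Matroid.restrict_ground_eq]; exact hA6
  have hpairsR : ∀ R : Set α, R ⊆ M.E → ∀ e ∈ (M ↾ R).E, ∀ f ∈ (M ↾ R).E, e ≠ f → (M ↾ R).eRk {e, f} = 2 := by
    intro R hR e he f hf hef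
    rw [Matroid.restrict_ground_eq] at he hf
    rw [M.restrict_eRk_eq (show ({e, f} : Set α) ⊆ R from by
      intro x hx
      rcases hx with rfl | rfl
      · exact he
      · exact hf)]
    exact hpairs e (hR he) f (hR hf) hef
  unfold ThmN.RLS
  rw [heq]
  have hAA : M.E \ (M.E \ A) = A := sdiff_sdiff_cancel_left hA
  have key := c025_nine_four_disjointSum_three_six (M ↾ A) (M ↾ (M.E \ A))
    (by simp only [Matroid.restrict_ground_eq]; exact disjoint_sdiff_right) hrA' hAE' hcolA (hpairsR A hA)
    hrB hBE hcolB (hpairsR (M.E \ A) hB)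
  -- the consumer has the parts in the other order; commute the disjoint sum
  rw [Matroid.disjointSum_comm] at key
  convert key using 3 <;> simp only [hAA]

/-- **`(9, 4)` for a coloop-free simple matroid of rank `9` on `14` points with a rank-`4` separator of `7`
points** — the `(4, 5)` split of the `(9, 5)` cell: `M = (M ↾ (E ∖ A)) ⊕ (M ↾ A)` with the first part of rank `5`
on `7` points. -/
theorem rls_nine_four_of_four_five_separator (M : Matroid α) [M.Finite] {A : Set α} (hA : A ⊆ M.E)
    (hsep : M.eRk A + M.eRk (M.E \ A) = M.eRank) (hA7 : A.ncard = 7) (hrA : M.eRk A = ((4 : ℕ) : ℕ∞))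
    (hpairs : ∀ e ∈ M.E, ∀ f ∈ M.E, e ≠ f → M.eRk {e, f} = 2) (hM : M.eRank = ((9 : ℕ) : ℕ∞))
    (hE : M.E.ncard = 14) (hcol : M.coloops = ∅) : ThmN.RLS M 9 4 := by
  have hB : M.E \ A ⊆ M.E := sdiff_subset
  have hsep' : M.eRk (M.E \ A) + M.eRk (M.E \ (M.E \ A)) = M.eRank := by
    rw [sdiff_sdiff_cancel_left hA, add_comm]; exact hsep
  have heq := eq_disjointSum_restrict_of_separator M hB hsep'
  haveI hBfin : (M ↾ (M.E \ A)).Finite := Matroid.restrict_finite (M.ground_finite.subset hB)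
  haveI hAfin : (M ↾ A).Finite := Matroid.restrict_finite (M.ground_finite.subset hA)
  have hcolB : (M ↾ (M.E \ A)).coloops = ∅ := restrict_coloops_eq_empty_of_separator M hB hsep' hcol
  have hcolA : (M ↾ A).coloops = ∅ := restrict_coloops_eq_empty_of_separator M hA hsep hcol
  have hrB : (M ↾ (M.E \ A)).eRank = ((5 : ℕ) : ℕ∞) := by
    rw [Matroid.eRank_restrict]
    have h := hsep
    rw [hrA, hM] at h
    have hfin : M.eRk (M.E \ A) ≠ ⊤ :=
      ((M.eRk_le_encard _).trans_lt (M.ground_finite.subset hB).encard_lt_top).ne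
    obtain ⟨r, hr⟩ := ENat.ne_top_iff_exists.mp hfin
    rw [← hr] at h ⊢
    have h' : 4 + r = 9 := by exact_mod_cast h
    have hr5 : r = 5 := by omega
    rw [hr5]
  have hBE : (M ↾ (M.E \ A)).E.ncard = 7 := by
    rw [Matroid.restrict_ground_eq, ncard_sdiff' hA M.ground_finite, hE, hA7]
  have hrA' : (M ↾ A).eRank = ((4 : ℕ) : ℕ∞) := by rw [Matroid.eRank_restrict]; exact hrA
  have hAE' : (M ↾ A).E.ncard = 7 := by rw [Matroid.restrict_ground_eq]; exact hA7
  have hpairsR : ∀ R : Set α, R ⊆ M.E → ∀ e ∈ (M ↾ R).E, ∀ f ∈ (M ↾ R).E, e ≠ f → (M ↾ R).eRk {e, f} = 2 := by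
    intro R hR e he f hf hef
    rw [Matroid.restrict_ground_eq] at he hf
    rw [M.restrict_eRk_eq (show ({e, f} : Set α) ⊆ R from by
      intro x hx
      rcases hx with rfl | rfl
      · exact he
      · exact hf)]
    exact hpairs e (hR he) f (hR hf) hef
  unfold ThmN.RLS
  rw [heq]
  have hAA : M.E \ (M.E \ A) = A := sdiff_sdiff_cancel_left hA
  have key := c025_nine_four_disjointSum_four_five (M ↾ A) (M ↾ (M.E \ A))
    (by simp only [Matroid.restrict_ground_eq]; exact disjoint_sdiff_right) hrA' hAE' hcolA (hpairsR A hA)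
    hrB hBE hcolB (hpairsR (M.E \ A) hB)
  rw [Matroid.disjointSum_comm] at key
  convert key using 3 <;> simp only [hAA]

/-- **`(9, 4)` for a matroid of rank `9` on `14` points with a rank-`2` separator of `4` points** — the `(7, 2)`
split (the part is `U_{2,4}` when all pairs have rank `2`). -/
theorem rls_nine_four_of_four_point_line_separator (M : Matroid α) [M.Finite] {A : Set α} (hA : A ⊆ M.E)
    (hsep : M.eRk A + M.eRk (M.E \ A) = M.eRank) (hA4 : A.ncard = 4) (hrA : M.eRk A = ((2 : ℕ) : ℕ∞))
    (hpairs : ∀ e ∈ M.E, ∀ f ∈ M.E, e ≠ f → M.eRk {e, f} = 2) (hM : M.eRank = ((9 : ℕ) : ℕ∞))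
    (hE : M.E.ncard = 14) : ThmN.RLS M 9 4 := by
  have hB : M.E \ A ⊆ M.E := sdiff_subset
  have hsep' : M.eRk (M.E \ A) + M.eRk (M.E \ (M.E \ A)) = M.eRank := by
    rw [sdiff_sdiff_cancel_left hA, add_comm]; exact hsep
  have heq := eq_disjointSum_restrict_of_separator M hB hsep'
  haveI hBfin : (M ↾ (M.E \ A)).Finite := Matroid.restrict_finite (M.ground_finite.subset hB)
  haveI hAfin : (M ↾ A).Finite := Matroid.restrict_finite (M.ground_finite.subset hA)
  have hrB : (M ↾ (M.E \ A)).eRank = ((7 : ℕ) : ℕ∞) := by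
    rw [Matroid.eRank_restrict]
    have h := hsep
    rw [hrA, hM] at h
    have hfin : M.eRk (M.E \ A) ≠ ⊤ :=
      ((M.eRk_le_encard _).trans_lt (M.ground_finite.subset hB).encard_lt_top).ne
    obtain ⟨r, hr⟩ := ENat.ne_top_iff_exists.mp hfin
    rw [← hr] at h ⊢
    have h' : 2 + r = 9 := by exact_mod_cast h
    have hr7 : r = 7 := by omega
    rw [hr7]
  have hBE : (M ↾ (M.E \ A)).E.ncard = 10 := by
    rw [Matroid.restrict_ground_eq, ncard_sdiff' hA M.ground_finite, hE, hA4]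
  have hrA' : (M ↾ A).eRank = ((2 : ℕ) : ℕ∞) := by rw [Matroid.eRank_restrict]; exact hrA
  have hAE' : (M ↾ A).E.ncard = 4 := by rw [Matroid.restrict_ground_eq]; exact hA4
  have hpairsA : ∀ e ∈ (M ↾ A).E, ∀ f ∈ (M ↾ A).E, e ≠ f → (M ↾ A).eRk {e, f} = 2 := by
    intro e he f hf hef
    rw [Matroid.restrict_ground_eq] at he hf
    rw [M.restrict_eRk_eq (show ({e, f} : Set α) ⊆ A from by
      intro x hx
      rcases hx with rfl | rfl
      · exact he
      · exact hf)]
    exact hpairs e (hA he) f (hA hf) hef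
  unfold ThmN.RLS
  rw [heq]
  have hAA : M.E \ (M.E \ A) = A := sdiff_sdiff_cancel_left hA
  have key := c025_nine_four_disjointSum_seven_two (M ↾ (M.E \ A)) (M ↾ A)
    (by simp only [Matroid.restrict_ground_eq]; exact disjoint_sdiff_left) hrB hBE hrA' hAE' hpairsA
  convert key using 3 <;> simp only [hAA]

/-- **`(9, 4)` for a matroid of rank `9` on `14` points with a rank-`2` separator of `5` points** — the `(2, 7)`
split (the part is `U_{2,5}` when all pairs have rank `2`). -/
theorem rls_nine_four_of_five_point_line_separator (M : Matroid α) [M.Finite] {A : Set α} (hA : A ⊆ M.E)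
    (hsep : M.eRk A + M.eRk (M.E \ A) = M.eRank) (hA5 : A.ncard = 5) (hrA : M.eRk A = ((2 : ℕ) : ℕ∞))
    (hpairs : ∀ e ∈ M.E, ∀ f ∈ M.E, e ≠ f → M.eRk {e, f} = 2) (hM : M.eRank = ((9 : ℕ) : ℕ∞))
    (hE : M.E.ncard = 14) : ThmN.RLS M 9 4 := by
  have hB : M.E \ A ⊆ M.E := sdiff_subset
  have hsep' : M.eRk (M.E \ A) + M.eRk (M.E \ (M.E \ A)) = M.eRank := by
    rw [sdiff_sdiff_cancel_left hA, add_comm]; exact hsep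
  have heq := eq_disjointSum_restrict_of_separator M hB hsep'
  haveI hBfin : (M ↾ (M.E \ A)).Finite := Matroid.restrict_finite (M.ground_finite.subset hB)
  haveI hAfin : (M ↾ A).Finite := Matroid.restrict_finite (M.ground_finite.subset hA)
  have hrB : (M ↾ (M.E \ A)).eRank = ((7 : ℕ) : ℕ∞) := by
    rw [Matroid.eRank_restrict]
    have h := hsep
    rw [hrA, hM] at h
    have hfin : M.eRk (M.E \ A) ≠ ⊤ :=
      ((M.eRk_le_encard _).trans_lt (M.ground_finite.subset hB).encard_lt_top).ne
    obtain ⟨r, hr⟩ := ENat.ne_top_iff_exists.mp hfin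
    rw [← hr] at h ⊢
    have h' : 2 + r = 9 := by exact_mod_cast h
    have hr7 : r = 7 := by omega
    rw [hr7]
  have hBE : (M ↾ (M.E \ A)).E.ncard = 9 := by
    rw [Matroid.restrict_ground_eq, ncard_sdiff' hA M.ground_finite, hE, hA5]
  have hrA' : (M ↾ A).eRank = ((2 : ℕ) : ℕ∞) := by rw [Matroid.eRank_restrict]; exact hrA
  have hAE' : (M ↾ A).E.ncard = 5 := by rw [Matroid.restrict_ground_eq]; exact hA5
  have hpairsA : ∀ e ∈ (M ↾ A).E, ∀ f ∈ (M ↾ A).E, e ≠ f → (M ↾ A).eRk {e, f} = 2 := by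
    intro e he f hf hef
    rw [Matroid.restrict_ground_eq] at he hf
    rw [M.restrict_eRk_eq (show ({e, f} : Set α) ⊆ A from by
      intro x hx
      rcases hx with rfl | rfl
      · exact he
      · exact hf)]
    exact hpairs e (hA he) f (hA hf) hef
  unfold ThmN.RLS
  rw [heq]
  have hAA : M.E \ (M.E \ A) = A := sdiff_sdiff_cancel_left hA
  have key := c025_nine_four_disjointSum_two_seven (M ↾ A) (M ↾ (M.E \ A))
    (by simp only [Matroid.restrict_ground_eq]; exact disjoint_sdiff_right) hrA' hAE' hpairsA hrB hBE
  rw [Matroid.disjointSum_comm] at key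
  convert key using 3 <;> simp only [hAA]

end S1

end PercRepro
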